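import Literature.Analysis.FluidPDE.TaoH1FourierMildClassical
import Literature.Analysis.FluidPDE.TaoH1FourierMildExists
import HarnessLib

/-!
# Discharge of `tao2011_fourier_local_existence` (Tao 2013, Thm. 5.4 (ii)+(iv), Fourier side)

Analysis/FluidPDE proof file (no definitions, no named facts). The named fact
`Literature.Analysis.FluidPDE.tao2011_fourier_local_existence` (`TaoH1FourierDecomposition.lean`;
T. Tao, *Localisation and compactness properties of the Navier–Stokes global regularity problem*,
Anal. PDE 6 (2013) 25–107 = arXiv:1108.1165, Thm. 5.4 = arXiv Thm. 31 (p. 18), items (ii) and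
(iv), for data given through their Fourier transform) was split in `TaoH1FourierMild.lean` into
the existence half `tao2011_sobolevMild_exists` (Thm. 5.4 (ii): the `X¹` Picard iteration) and the
regularity half `sobolevMild_classical` (Thm. 5.4 (iv) with (i)), with the proved assembly
`tao2011_fourier_local_existence_of_mild`. Both halves have since been discharged
(`tao2011_sobolevMild_exists_holds`, `TaoH1FourierMildExists.lean`; `sobolevMild_classical_holds`,
`TaoH1FourierMildClassical.lean`), in two files neither of which imports the other. This file
joins them:

* `tao2011_fourier_local_existence_holds : tao2011_fourier_local_existence`.

Consequently the trust base of `tao2011_smooth_local_existence` (`TaoH1LocalExistence.lean`) is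
the single Plancherel fact `sobolev_fourierDatum_of_smooth` (via the accepted
`tao2011_smooth_local_existence_of_fourier`), and through
`tao2011_H1_local_almost_regular_of_smooth_local_existence` (`TaoH1AlmostRegularAssembly.lean`)
and `ladyzhenskaya_prodi_serrin_of_tao` (`NSSerrinRegularityTao.lean`) the same holds for
`tao2011_H1_local_almost_regular` and for the Ladyzhenskaya–Prodi–Serrin theorem
`ladyzhenskaya_prodi_serrin` (ns.S07).

## Mathlib / tree search

`lean search tao2011_fourier_local_existence_holds`: absent before this file. Nothing else is
declared here.

## References

* T. Tao, Anal. PDE 6 (2013) 25–107 = arXiv:1108.1165, Thm. 5.4 (arXiv Thm. 31, p. 18), (ii),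
  (iv) and the note closing the proof of (iv). [Tao2011]
-/

noncomputable section

namespace Literature.Analysis.FluidPDE

/-- **Tao 2013, Thm. 5.4 (ii)+(iv) on the Fourier side, discharged.** There is an absolute
constant `c > 0` such that for `ν > 0`, `T > 0` and a Fourier datum `a` of Sobolev class with
`(∫ (1 + 4π²‖ξ‖²)|a|²)² T ≤ c ν³` there is a classical solution of the unforced Navier–Stokes
system on `[0, T] × ℝ³` from `synthVel a` with `u, ∂ₜu, p ∈ L^∞_t H^k_x` for all `k` and
`u ∈ C([0, T]; L²)`. Proof: the accepted assembly `tao2011_fourier_local_existence_of_mild` fed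
with the two discharged halves `tao2011_sobolevMild_exists_holds` (the `X¹` contraction,
Thm. 5.4 (ii)) and `sobolevMild_classical_holds` (synthesis and Sobolev bounds, Thm. 5.4 (iv)
with (i)). [cite: Tao2011, Thm. 5.4 (ii)+(iv)] -/
theorem tao2011_fourier_local_existence_holds : tao2011_fourier_local_existence :=
  tao2011_fourier_local_existence_of_mild tao2011_sobolevMild_exists_holds
    sobolevMild_classical_holds

end Literature.Analysis.FluidPDE

end
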